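import Mathlib
import HarnessLib
import Literature.NumberTheory.LFunctions.HorocycleStripFourier

/-!
# The smooth-multiplier lemma for exponential sums over a full period (PROVED)

Topic `Literature/NumberTheory/LFunctions` (the decoupling cone of Bourgain's bound
`|ζ(1/2 + it)| ≪ t^{13/84 + ε}`; companion of `ParabolaDiscreteRestriction.lean`). In J. Bourgain,
*Decoupling, exponential sums and the Riemann zeta function*, J. Amer. Math. Soc. 30 (2017),
Taylor remainders of size `O(1)` in the phases are repeatedly discarded with the words "the
`o(1)`-term … producing a harmless smooth Fourier multiplier that may be ignored" (§2, after
(1.23)), "periodicity considerations and a change of variables in `z₁, z₁'` permit to replace the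
phase (2.5) by …" (§3, (2.5)–(2.7)), and again between (2.9) and (2.10). The rigorous content is
the following classical lemma, proved here in two layers:

* `integral_norm_rpow_expSum_mul_le` — **the `ℓ¹`-multiplier lemma**: if
  `g(m) = ∑_k b_k e(β_k m)` with `∑_k |b_k| = A < ∞`, then for every finite exponential sum
  `F(u) = ∑_{m∈S} c_m e(mu)` with integer frequencies and every `p ≥ 1`,
  `∫₀¹ |∑_m c_m g(m) e(mu)|^p du ≤ A^p ∫₀¹ |F|^p` (pointwise `∑ c_m g(m) e(mu) = ∑_k b_k F(u + β_k)`,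
  the weighted power mean `rpow_sum_mul_le_of_nonneg`, dominated convergence, and invariance of
  `∫₀¹ |F|^p` under translation);
* `summable_norm_coeff_of_periodic` — a `1`-periodic `C²` function `Φ` with `|Φ| ≤ B₀`,
  `|Φ''| ≤ B₂` has Fourier coefficients `b_k = ∫₀¹ Φ e(-k·)` with `|b_k| ≤ B₂/(4π²k²)` (two periodic
  integrations by parts, the tree's `HorocycleStripFourier.integral_mul_exp_eq_of_periodic`), so
  `∑ |b_k| ≤ B₀ + B₂/12` (using `∑_{k∈ℤ} k⁻² = π²/3`);
* `integral_norm_rpow_expSum_mul_periodic_le` — **the smooth multiplier lemma**: consequently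
  `∫₀¹ |∑_m c_m Φ(mθ) e(mu)|^p ≤ (B₀ + B₂/12)^p ∫₀¹ |∑_m c_m e(mu)|^p` for every `θ ∈ ℝ` (the Fourier
  series converges to `Φ` pointwise: the tree's `HorocycleStripFourier.hasSum_fourier_of_periodic`).

Everything here is PROVED (Mathlib + the tree); no definition and no named fact is introduced.

## References

* J. Bourgain, *Decoupling, exponential sums and the Riemann zeta function*, J. Amer. Math. Soc.
  30 (2017), 205–224 — §2 after (1.23); §3 (2.5)–(2.7), (2.9)–(2.10). [BourgainJAMS2017]
* Y. Katznelson, *An Introduction to Harmonic Analysis*, 3rd ed., CUP 2004, Ch. I §4 (decay of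
  Fourier coefficients of smooth functions), for orientation. [Katznelson2004]
-/

noncomputable section

open Finset MeasureTheory intervalIntegral Complex Filter Topology
open scoped Real

namespace Literature.NumberTheory.LFunctions
namespace SmoothMultiplier
/-! ### The `ℓ¹`-multiplier lemma ("a harmless smooth Fourier multiplier") -/

/-- Weighted power mean, finite form: `(∑ wᵢ fᵢ)^p ≤ (∑ wᵢ)^{p-1} ∑ wᵢ fᵢ^p` for `p ≥ 1`,
`wᵢ, fᵢ ≥ 0`. [folklore] -/
theorem rpow_sum_mul_le_of_nonneg {ι : Type*} (s : Finset ι) {p : ℝ} (hp : 1 ≤ p) (w f : ι → ℝ)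
    (hw : ∀ i, 0 ≤ w i) (hf : ∀ i, 0 ≤ f i) :
    (∑ i ∈ s, w i * f i) ^ p ≤ (∑ i ∈ s, w i) ^ (p - 1) * ∑ i ∈ s, w i * f i ^ p := by
  have h := Real.inner_le_weight_mul_Lp_of_nonneg s hp w f hw hf
  have hp0 : 0 < p := by linarith
  have hW : 0 ≤ ∑ i ∈ s, w i := Finset.sum_nonneg fun i _ => hw i
  have hWF : 0 ≤ ∑ i ∈ s, w i * f i ^ p :=
    Finset.sum_nonneg fun i _ => mul_nonneg (hw i) (Real.rpow_nonneg (hf i) _)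
  have hL : 0 ≤ ∑ i ∈ s, w i * f i := Finset.sum_nonneg fun i _ => mul_nonneg (hw i) (hf i)
  calc (∑ i ∈ s, w i * f i) ^ p
      ≤ ((∑ i ∈ s, w i) ^ (1 - p⁻¹) * (∑ i ∈ s, w i * f i ^ p) ^ p⁻¹) ^ p :=
        Real.rpow_le_rpow hL h hp0.le
    _ = (∑ i ∈ s, w i) ^ (p - 1) * ∑ i ∈ s, w i * f i ^ p := by
        rw [Real.mul_rpow (Real.rpow_nonneg hW _) (Real.rpow_nonneg hWF _), ← Real.rpow_mul hW,
          ← Real.rpow_mul hWF]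
        have e1 : (1 - p⁻¹) * p = p - 1 := by field_simp
        have e2 : p⁻¹ * p = 1 := by field_simp
        rw [e1, e2, Real.rpow_one]

/-- **The `ℓ¹`-multiplier lemma.** Let `F(u) = ∑_{m ∈ S} c_m e(mu)` be a finite exponential sum with
integer frequencies and let the multiplier `g` have an absolutely convergent expansion
`g(m) = ∑_k b_k e(β_k m)` on `S`. Then for every `p ≥ 1`

  `∫₀¹ |∑_{m∈S} c_m g(m) e(mu)|^p du ≤ (∑_k |b_k|)^p ∫₀¹ |∑_{m∈S} c_m e(mu)|^p du`:

pointwise `∑ c_m g(m) e(mu) = ∑_k b_k F(u + β_k)`, so by the weighted power-mean inequality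
`|·|^p ≤ (∑|b_k|)^{p-1} ∑_k |b_k| |F(u + β_k)|^p`, and `∫₀¹ |F(u + β)|^p du = ∫₀¹ |F|^p` by
periodicity. This is the rigorous content of "a harmless smooth Fourier multiplier that may be
ignored" (Bourgain 2017, after (1.23); likewise in the passage from (2.5) to (2.6)–(2.7) and from
(2.9) to (2.10), where the linear variable ranges over a full period): a smooth factor `G(m/P)`
with `G = ∑ Ĝ(k) e(k·)` absolutely summable costs at most the constant `(∑_k |Ĝ(k)|)^p`.
[cite: BourgainJAMS2017, §2 after (1.23); §3 (2.5)–(2.7), (2.9)–(2.10)] -/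
theorem integral_norm_rpow_expSum_mul_le {ι : Type*} [Countable ι] (S : Finset ℤ) (c g : ℤ → ℂ)
    (b : ι → ℂ) (β : ι → ℝ) (hb : Summable fun k => ‖b k‖)
    (hg : ∀ m ∈ S, HasSum (fun k => b k * Complex.exp (2 * π * I * ↑(β k * m))) (g m))
    {p : ℝ} (hp : 1 ≤ p) :
    ∫ u in (0 : ℝ)..1, ‖∑ m ∈ S, c m * g m * Complex.exp (2 * π * I * ↑((m : ℝ) * u))‖ ^ p ≤
      (∑' k, ‖b k‖) ^ p *
        ∫ u in (0 : ℝ)..1, ‖∑ m ∈ S, c m * Complex.exp (2 * π * I * ↑((m : ℝ) * u))‖ ^ p := by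
  classical
  have hp0 : 0 < p := by linarith
  have hp1 : 0 ≤ p - 1 := by linarith
  -- the unperturbed sum `F`, its sup bound `M` and its periodicity
  obtain ⟨F, hF⟩ : ∃ F : ℝ → ℂ, ∀ u, F u =
      ∑ m ∈ S, c m * Complex.exp (2 * π * I * ↑((m : ℝ) * u)) := ⟨_, fun _ => rfl⟩
  obtain ⟨G, hG⟩ : ∃ G : ℝ → ℂ, ∀ u, G u =
      ∑ m ∈ S, c m * g m * Complex.exp (2 * π * I * ↑((m : ℝ) * u)) := ⟨_, fun _ => rfl⟩
  have hFcont : Continuous F := by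
    have : F = fun u => ∑ m ∈ S, c m * Complex.exp (2 * π * I * ↑((m : ℝ) * u)) := funext hF
    rw [this]
    fun_prop
  have hGcont : Continuous G := by
    have : G = fun u => ∑ m ∈ S, c m * g m * Complex.exp (2 * π * I * ↑((m : ℝ) * u)) := funext hG
    rw [this]
    fun_prop
  set M : ℝ := ∑ m ∈ S, ‖c m‖ with hM
  have hM0 : 0 ≤ M := Finset.sum_nonneg fun m _ => norm_nonneg _
  have hFle : ∀ u, ‖F u‖ ≤ M := by
    intro u
    rw [hF]
    refine (norm_sum_le _ _).trans (le_of_eq (Finset.sum_congr rfl fun m _ => ?_))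
    rw [norm_mul, Complex.norm_exp]
    simp
  have hFper : Function.Periodic (fun v => ‖F v‖ ^ p) 1 := by
    intro v
    simp only
    rw [hF, hF]
    congr 2
    refine Finset.sum_congr rfl fun m _ => ?_
    congr 1
    have e : (2 * π * I * ↑((m : ℝ) * (v + 1)) : ℂ) =
        2 * π * I * ↑((m : ℝ) * v) + (m : ℂ) * (2 * π * I) := by push_cast; ring
    rw [e, Complex.exp_add, Complex.exp_int_mul_two_pi_mul_I, mul_one]
  -- Step 1: pointwise, `G(u) = ∑_k b_k F(u + β_k)`
  have hpt : ∀ u : ℝ, HasSum (fun k => b k * F (u + β k)) (G u) := by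
    intro u
    have h1 : ∀ m ∈ S, HasSum (fun k => c m * (b k * Complex.exp (2 * π * I * ↑(β k * m))) *
        Complex.exp (2 * π * I * ↑((m : ℝ) * u)))
        (c m * g m * Complex.exp (2 * π * I * ↑((m : ℝ) * u))) :=
      fun m hm => ((hg m hm).mul_left (c m)).mul_right _
    have h2 := hasSum_sum h1
    rw [← hG] at h2
    have hfun : (fun k => b k * F (u + β k)) = fun k => ∑ m ∈ S,
        c m * (b k * Complex.exp (2 * π * I * ↑(β k * m))) *
          Complex.exp (2 * π * I * ↑((m : ℝ) * u)) := by
      funext k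
      rw [hF, Finset.mul_sum]
      refine Finset.sum_congr rfl fun m _ => ?_
      have e : Complex.exp (2 * π * I * ↑((m : ℝ) * (u + β k))) =
          Complex.exp (2 * π * I * ↑(β k * m)) * Complex.exp (2 * π * I * ↑((m : ℝ) * u)) := by
        rw [← Complex.exp_add]
        congr 1
        push_cast
        ring
      rw [e]
      ring
    rw [hfun]
    exact h2
  -- Step 2: pointwise weighted power mean
  set A : ℝ := ∑' k, ‖b k‖ with hA
  have hA0 : 0 ≤ A := tsum_nonneg fun k => norm_nonneg _
  have hTsum : ∀ u, Summable (fun k => ‖b k‖ * ‖F (u + β k)‖ ^ p) := fun u =>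
    Summable.of_nonneg_of_le (fun k => by positivity) (fun k =>
      mul_le_mul_of_nonneg_left (Real.rpow_le_rpow (norm_nonneg _) (hFle _) hp0.le)
        (norm_nonneg _)) (hb.mul_right (M ^ p))
  have hJensen : ∀ u, ‖G u‖ ^ p ≤ A ^ (p - 1) * ∑' k, ‖b k‖ * ‖F (u + β k)‖ ^ p := by
    intro u
    have hlim : Tendsto (fun K : Finset ι => ‖∑ k ∈ K, b k * F (u + β k)‖ ^ p) atTop
        (𝓝 (‖G u‖ ^ p)) := by
      have h1 : Tendsto (fun K : Finset ι => ∑ k ∈ K, b k * F (u + β k)) atTop (𝓝 (G u)) :=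
        hpt u
      exact (h1.norm).rpow_const (Or.inr hp0.le)
    refine le_of_tendsto' hlim fun K => ?_
    have hs0 : 0 ≤ ∑ k ∈ K, ‖b k‖ := Finset.sum_nonneg fun k _ => norm_nonneg _
    calc ‖∑ k ∈ K, b k * F (u + β k)‖ ^ p
        ≤ (∑ k ∈ K, ‖b k‖ * ‖F (u + β k)‖) ^ p := by
          apply Real.rpow_le_rpow (norm_nonneg _) _ hp0.le
          calc ‖∑ k ∈ K, b k * F (u + β k)‖ ≤ ∑ k ∈ K, ‖b k * F (u + β k)‖ := norm_sum_le _ _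
            _ = ∑ k ∈ K, ‖b k‖ * ‖F (u + β k)‖ := by simp_rw [norm_mul]
      _ ≤ (∑ k ∈ K, ‖b k‖) ^ (p - 1) * ∑ k ∈ K, ‖b k‖ * ‖F (u + β k)‖ ^ p :=
          rpow_sum_mul_le_of_nonneg K hp _ _ (fun k => norm_nonneg _) (fun k => norm_nonneg _)
      _ ≤ A ^ (p - 1) * ∑' k, ‖b k‖ * ‖F (u + β k)‖ ^ p := by
          apply mul_le_mul _ _ (Finset.sum_nonneg fun k _ => by positivity) (Real.rpow_nonneg hA0 _)
          · exact Real.rpow_le_rpow hs0 (hb.sum_le_tsum K (fun k _ => norm_nonneg _)) hp1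
          · exact (hTsum u).sum_le_tsum K (fun k _ => by positivity)
  -- Step 3: integrate; the translates have the same integral by periodicity
  set J : ℝ := ∫ u in (0 : ℝ)..1, ‖F u‖ ^ p with hJ
  have hJβ : ∀ s : ℝ, (∫ u in (0 : ℝ)..1, ‖F (u + s)‖ ^ p) = J := by
    intro s
    have h1 := intervalIntegral.integral_comp_add_right (fun v => ‖F v‖ ^ p) s (a := 0) (b := 1)
    rw [h1, zero_add, add_comm 1 s, hFper.intervalIntegral_add_eq s 0, zero_add]
  have hTcont : Continuous fun u => ∑' k, ‖b k‖ * ‖F (u + β k)‖ ^ p := by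
    refine continuous_tsum (fun k => ?_) (hb.mul_right (M ^ p)) (fun k u => ?_)
    · exact continuous_const.mul ((hFcont.comp (continuous_id.add continuous_const)).norm.rpow_const
        (fun _ => Or.inr hp0.le))
    · rw [Real.norm_of_nonneg (by positivity)]
      exact mul_le_mul_of_nonneg_left (Real.rpow_le_rpow (norm_nonneg _) (hFle _) hp0.le)
        (norm_nonneg _)
  have hTint : (∫ u in (0 : ℝ)..1, ∑' k, ‖b k‖ * ‖F (u + β k)‖ ^ p) = A * J := by
    have hsum : HasSum (fun k => ∫ u in (0 : ℝ)..1, ‖b k‖ * ‖F (u + β k)‖ ^ p)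
        (∫ u in (0 : ℝ)..1, ∑' k, ‖b k‖ * ‖F (u + β k)‖ ^ p) := by
      refine intervalIntegral.hasSum_integral_of_dominated_convergence
        (fun k _ => ‖b k‖ * M ^ p) (fun k => ?_) (fun k => Eventually.of_forall fun u _ => ?_)
        (Eventually.of_forall fun u _ => hb.mul_right (M ^ p)) intervalIntegrable_const
        (Eventually.of_forall fun u _ => (hTsum u).hasSum)
      · exact (continuous_const.mul ((hFcont.comp (continuous_id.add continuous_const)).norm.rpow_const
          (fun _ => Or.inr hp0.le))).aestronglyMeasurable
      · rw [Real.norm_of_nonneg (by positivity)]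
        exact mul_le_mul_of_nonneg_left (Real.rpow_le_rpow (norm_nonneg _) (hFle _) hp0.le)
          (norm_nonneg _)
    have hsum' : HasSum (fun k => ∫ u in (0 : ℝ)..1, ‖b k‖ * ‖F (u + β k)‖ ^ p) (A * J) := by
      have e : (fun k => ∫ u in (0 : ℝ)..1, ‖b k‖ * ‖F (u + β k)‖ ^ p) = fun k => ‖b k‖ * J := by
        funext k
        rw [intervalIntegral.integral_const_mul, hJβ]
      rw [e]
      exact hb.hasSum.mul_right J
    exact hsum.unique hsum'
  have hGint : IntervalIntegrable (fun u => ‖G u‖ ^ p) volume 0 1 :=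
    (hGcont.norm.rpow_const (fun _ => Or.inr hp0.le)).intervalIntegrable _ _
  have hmain : (∫ u in (0 : ℝ)..1, ‖G u‖ ^ p) ≤ A ^ (p - 1) * (A * J) := by
    calc (∫ u in (0 : ℝ)..1, ‖G u‖ ^ p)
        ≤ ∫ u in (0 : ℝ)..1, A ^ (p - 1) * ∑' k, ‖b k‖ * ‖F (u + β k)‖ ^ p :=
          intervalIntegral.integral_mono_on zero_le_one hGint
            ((continuous_const.mul hTcont).intervalIntegrable _ _) (fun u _ => hJensen u)
      _ = A ^ (p - 1) * (A * J) := by rw [intervalIntegral.integral_const_mul, hTint]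
  -- Step 4: `A^{p-1} · A = A^p`
  have hJ0 : 0 ≤ J := intervalIntegral.integral_nonneg zero_le_one fun u _ => by positivity
  have hfin : A ^ (p - 1) * (A * J) ≤ A ^ p * J := by
    rcases hA0.eq_or_lt with h | h
    · rw [← h, zero_mul, mul_zero, Real.zero_rpow hp0.ne', zero_mul]
    · rw [← mul_assoc, ← Real.rpow_add_one h.ne', sub_add_cancel]
  have hLHS : (∫ u in (0 : ℝ)..1,
      ‖∑ m ∈ S, c m * g m * Complex.exp (2 * π * I * ↑((m : ℝ) * u))‖ ^ p) =
      ∫ u in (0 : ℝ)..1, ‖G u‖ ^ p := by simp_rw [hG]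
  have hRHS : (∫ u in (0 : ℝ)..1,
      ‖∑ m ∈ S, c m * Complex.exp (2 * π * I * ↑((m : ℝ) * u))‖ ^ p) = J := by
    rw [hJ]; simp_rw [hF]
  rw [hLHS, hRHS]
  exact hmain.trans hfin

/-! ### Smooth periodic multipliers: `C²` and `1`-periodic ⇒ absolutely summable Fourier series -/

open Literature.NumberTheory.LFunctions.HorocycleStripFourier (hasSum_fourier_of_periodic
  integral_mul_exp_eq_of_periodic norm_exp_neg_two_pi_mul)

/-- The coefficient integrals `∫₀¹ ψ(x) e(-kx) dx` are bounded by `sup |ψ|`. [folklore] -/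
theorem norm_coeff_le_of_norm_le {ψ : ℝ → ℂ} {C : ℝ} (hC : ∀ x, ‖ψ x‖ ≤ C) (k : ℤ) :
    ‖∫ x in (0 : ℝ)..1, ψ x * Complex.exp (-(2 * π * I * k * x))‖ ≤ C := by
  have h := intervalIntegral.norm_integral_le_of_norm_le_const (a := (0 : ℝ)) (b := 1)
    (f := fun x => ψ x * Complex.exp (-(2 * π * I * k * x))) (C := C) (fun x _ => by
      rw [norm_mul, norm_exp_neg_two_pi_mul, mul_one]; exact hC x)
  simpa using h

/-- **Fourier coefficients of a `C²` periodic function.** If `Φ : ℝ → ℂ` is `1`-periodic with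
`Φ'' ` continuous, `|Φ| ≤ B₀` and `|Φ''| ≤ B₂`, then its Fourier coefficients
`b_k = ∫₀¹ Φ(x) e(-kx) dx` satisfy `|b_k| ≤ B₂/(4π²k²)` (`k ≠ 0`, two periodic integrations by
parts) and `|b_0| ≤ B₀`; hence `∑_k |b_k| ≤ B₀ + (B₂/4π²)(π²/3) = B₀ + B₂/12`. [folklore] -/
theorem summable_norm_coeff_of_periodic {Φ Φ' Φ'' : ℝ → ℂ} (hΦ : ∀ x, HasDerivAt Φ (Φ' x) x)
    (hΦ' : ∀ x, HasDerivAt Φ' (Φ'' x) x) (hΦ''c : Continuous Φ'') (hper : ∀ x, Φ (x + 1) = Φ x)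
    {B₀ B₂ : ℝ} (hB₀ : ∀ x, ‖Φ x‖ ≤ B₀) (hB₂ : ∀ x, ‖Φ'' x‖ ≤ B₂) :
    (Summable fun k : ℤ => ‖∫ x in (0 : ℝ)..1, Φ x * Complex.exp (-(2 * π * I * k * x))‖) ∧
      (∑' k : ℤ, ‖∫ x in (0 : ℝ)..1, Φ x * Complex.exp (-(2 * π * I * k * x))‖) ≤
        B₀ + B₂ / 12 := by
  classical
  have hΦ'c : Continuous Φ' := continuous_iff_continuousAt.2 fun x => (hΦ' x).continuousAt
  have hper' : ∀ x, Φ' (x + 1) = Φ' x := by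
    intro x
    have h1 : HasDerivAt (fun y => Φ (y + 1)) (Φ' (x + 1)) x :=
      HasDerivAt.comp_add_const x 1 (hΦ (x + 1))
    have h2 : (fun y => Φ (y + 1)) = Φ := funext hper
    rw [h2] at h1
    exact h1.unique (hΦ x)
  obtain ⟨b, hb⟩ : ∃ b : ℤ → ℂ, ∀ k, b k =
      ∫ x in (0 : ℝ)..1, Φ x * Complex.exp (-(2 * π * I * k * x)) := ⟨_, fun _ => rfl⟩
  have hB₂0 : 0 ≤ B₂ := (norm_nonneg _).trans (hB₂ 0)
  have hb0 : ∀ k, ‖b k‖ ≤ B₀ := fun k => by rw [hb]; exact norm_coeff_le_of_norm_le hB₀ k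
  have hbk : ∀ k : ℤ, k ≠ 0 → ‖b k‖ ≤ B₂ / (4 * π ^ 2) * (1 / (k : ℝ) ^ 2) := by
    intro k hk
    have e1 := integral_mul_exp_eq_of_periodic hΦ hΦ'c (by simpa using hper 0) hk
    have e2 := integral_mul_exp_eq_of_periodic hΦ' hΦ''c (by simpa using hper' 0) hk
    have e3 : b k = (1 / (2 * π * I * k)) ^ 2 *
        ∫ x in (0 : ℝ)..1, Φ'' x * Complex.exp (-(2 * π * I * k * x)) := by
      rw [hb, e1, e2]
      ring
    have hn : ‖(1 / (2 * π * I * k) : ℂ)‖ = 1 / (2 * π * |(k : ℝ)|) := by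
      rw [norm_div, norm_one]
      congr 1
      rw [norm_mul, norm_mul, norm_mul, Complex.norm_I, mul_one, Complex.norm_intCast,
        Complex.norm_real, Real.norm_of_nonneg Real.pi_pos.le, Complex.norm_two]
    rw [e3, norm_mul, norm_pow, hn]
    have hI := norm_coeff_le_of_norm_le hB₂ k
    have hk' : (k : ℝ) ≠ 0 := by exact_mod_cast hk
    have habs : 0 < |(k : ℝ)| := abs_pos.2 hk'
    calc (1 / (2 * π * |(k : ℝ)|)) ^ 2 *
          ‖∫ x in (0 : ℝ)..1, Φ'' x * Complex.exp (-(2 * π * I * k * x))‖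
        ≤ (1 / (2 * π * |(k : ℝ)|)) ^ 2 * B₂ := mul_le_mul_of_nonneg_left hI (sq_nonneg _)
      _ = B₂ / (4 * π ^ 2) * (1 / (k : ℝ) ^ 2) := by
          rw [← sq_abs (k : ℝ)]
          field_simp
          ring
  -- the majorant `h`
  obtain ⟨h, hh⟩ : ∃ h : ℤ → ℝ, ∀ k, h k =
      (if k = 0 then B₀ else 0) + B₂ / (4 * π ^ 2) * (1 / (k : ℝ) ^ 2) := ⟨_, fun _ => rfl⟩
  have hle : ∀ k, ‖b k‖ ≤ h k := by
    intro k
    rw [hh]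
    by_cases hk : k = 0
    · subst hk
      simp only [if_true, Int.cast_zero, ne_eq, OfNat.ofNat_ne_zero, not_false_eq_true,
        zero_pow, div_zero, mul_zero, add_zero]
      exact hb0 0
    · rw [if_neg hk, zero_add]
      exact hbk k hk
  -- `∑_{k ∈ ℤ} 1/k² = π²/3` (the term `k = 0` is `1/0 = 0`; the same computation appears as
  -- `TaoTeravainen.hasSum_one_div_int_sq` in the Barriers tree, which is not imported here)
  have hzeta : HasSum (fun k : ℤ => 1 / (k : ℝ) ^ 2) (π ^ 2 / 3) := by
    have h1 : HasSum (fun n : ℕ => 1 / (n : ℝ) ^ 2) (π ^ 2 / 6) := hasSum_zeta_two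
    have h2 : HasSum (fun n : ℕ => 1 / ((n : ℝ) + 1) ^ 2) (π ^ 2 / 6) := by
      have h := (hasSum_nat_add_iff' (f := fun n : ℕ => 1 / (n : ℝ) ^ 2) 1).mpr h1
      simp only [Finset.sum_range_one, Nat.cast_zero, ne_eq, OfNat.ofNat_ne_zero,
        not_false_eq_true, zero_pow, div_zero, sub_zero, Nat.cast_add, Nat.cast_one] at h
      exact h
    have h3 : HasSum (fun n : ℕ => 1 / (((n : ℤ) : ℝ)) ^ 2) (π ^ 2 / 6) := by
      have e : (fun n : ℕ => 1 / (((n : ℤ) : ℝ)) ^ 2) = fun n : ℕ => 1 / (n : ℝ) ^ 2 := by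
        funext n
        rw [Int.cast_natCast]
      rw [e]
      exact h1
    have h4 : HasSum (fun n : ℕ => 1 / (((-((n : ℤ) + 1) : ℤ)) : ℝ) ^ 2) (π ^ 2 / 6) := by
      have e : (fun n : ℕ => 1 / (((-((n : ℤ) + 1) : ℤ)) : ℝ) ^ 2) =
          fun n : ℕ => 1 / ((n : ℝ) + 1) ^ 2 := by
        funext n
        have e1 : (((-((n : ℤ) + 1) : ℤ)) : ℝ) = -((n : ℝ) + 1) := by push_cast; ring
        rw [e1, neg_sq]
      rw [e]
      exact h2
    have h5 := HasSum.of_nat_of_neg_add_one (f := fun k : ℤ => 1 / (k : ℝ) ^ 2) h3 h4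
    have e : π ^ 2 / 6 + π ^ 2 / 6 = π ^ 2 / 3 := by ring
    rw [e] at h5
    exact h5
  have hsumh : HasSum h (B₀ + B₂ / (4 * π ^ 2) * (π ^ 2 / 3)) := by
    have h1 : HasSum (fun k : ℤ => (if k = 0 then B₀ else 0)) B₀ := hasSum_ite_eq 0 B₀
    have h2 := hzeta.mul_left (B₂ / (4 * π ^ 2))
    have h3 := h1.add h2
    have e : h = fun k : ℤ => (if k = 0 then B₀ else 0) + B₂ / (4 * π ^ 2) * (1 / (k : ℝ) ^ 2) :=
      funext hh
    rw [e]
    exact h3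
  have hval : B₀ + B₂ / (4 * π ^ 2) * (π ^ 2 / 3) = B₀ + B₂ / 12 := by
    field_simp
    ring
  have hsb : Summable fun k : ℤ => ‖b k‖ :=
    Summable.of_nonneg_of_le (fun k => norm_nonneg _) hle hsumh.summable
  have hfun : (fun k : ℤ => ‖∫ x in (0 : ℝ)..1, Φ x * Complex.exp (-(2 * π * I * k * x))‖) =
      fun k => ‖b k‖ := funext fun k => by rw [hb]
  rw [hfun]
  refine ⟨hsb, ?_⟩
  calc ∑' k : ℤ, ‖b k‖ ≤ ∑' k : ℤ, h k := Summable.tsum_le_tsum hle hsb hsumh.summable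
    _ = B₀ + B₂ / 12 := by rw [hsumh.tsum_eq, hval]

/-- **Smooth multiplier lemma** (the form of `integral_norm_rpow_expSum_mul_le` used for Taylor
remainders): if `Φ : ℝ → ℂ` is `1`-periodic and `C²` with `|Φ| ≤ B₀`, `|Φ''| ≤ B₂`, then for every
finite exponential sum with integer frequencies, every `θ ∈ ℝ` and every `p ≥ 1`,

  `∫₀¹ |∑_{m∈S} c_m Φ(mθ) e(mu)|^p du ≤ (B₀ + B₂/12)^p ∫₀¹ |∑_{m∈S} c_m e(mu)|^p du`.

(In Bourgain 2017 this is "the `o(1)`-term producing a harmless smooth Fourier multiplier that may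
be ignored": e.g. in (2.5), for `|m| < N^{1/2}`, the dropped terms are `Φ(m/N^{1/2})` for a phase
factor `Φ(s) = e(E(s))` with `E` smooth and `O(1)` together with two derivatives, and `z₁`, hence
the coefficient of `m`, ranges over a full period.)
[cite: BourgainJAMS2017, §2 after (1.23); §3 (2.5)–(2.7), (2.9)–(2.10)] -/
theorem integral_norm_rpow_expSum_mul_periodic_le {Φ Φ' Φ'' : ℝ → ℂ}
    (hΦ : ∀ x, HasDerivAt Φ (Φ' x) x) (hΦ' : ∀ x, HasDerivAt Φ' (Φ'' x) x)
    (hΦ''c : Continuous Φ'') (hper : ∀ x, Φ (x + 1) = Φ x) {B₀ B₂ : ℝ}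
    (hB₀ : ∀ x, ‖Φ x‖ ≤ B₀) (hB₂ : ∀ x, ‖Φ'' x‖ ≤ B₂) (S : Finset ℤ) (c : ℤ → ℂ) (θ : ℝ)
    {p : ℝ} (hp : 1 ≤ p) :
    ∫ u in (0 : ℝ)..1, ‖∑ m ∈ S, c m * Φ (m * θ) * Complex.exp (2 * π * I * ↑((m : ℝ) * u))‖ ^ p
      ≤ (B₀ + B₂ / 12) ^ p *
        ∫ u in (0 : ℝ)..1, ‖∑ m ∈ S, c m * Complex.exp (2 * π * I * ↑((m : ℝ) * u))‖ ^ p := by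
  obtain ⟨hsb, hle⟩ := summable_norm_coeff_of_periodic hΦ hΦ' hΦ''c hper hB₀ hB₂
  have hΦc : Continuous Φ := continuous_iff_continuousAt.2 fun x => (hΦ x).continuousAt
  have hg : ∀ m ∈ S, HasSum (fun k : ℤ =>
      (∫ x in (0 : ℝ)..1, Φ x * Complex.exp (-(2 * π * I * k * x))) *
        Complex.exp (2 * π * I * ↑((k : ℝ) * θ * m))) (Φ (m * θ)) := by
    intro m _
    have h := hasSum_fourier_of_periodic hΦc hper hsb.of_norm ((m : ℝ) * θ)
    have e : (fun k : ℤ => (∫ x in (0 : ℝ)..1, Φ x * Complex.exp (-(2 * π * I * k * x))) *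
        Complex.exp (2 * π * I * ↑((k : ℝ) * θ * m))) = fun k : ℤ =>
        (∫ x in (0 : ℝ)..1, Φ x * Complex.exp (-(2 * π * I * k * x))) *
          Complex.exp (2 * π * I * k * (((m : ℝ) * θ : ℝ) : ℂ)) := by
      funext k
      congr 2
      push_cast
      ring
    rw [e]
    exact h
  have hmain := integral_norm_rpow_expSum_mul_le S c (fun m => Φ (m * θ))
    (fun k : ℤ => ∫ x in (0 : ℝ)..1, Φ x * Complex.exp (-(2 * π * I * k * x)))
    (fun k : ℤ => (k : ℝ) * θ) hsb hg hp
  refine hmain.trans (mul_le_mul_of_nonneg_right ?_ ?_)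
  · exact Real.rpow_le_rpow (tsum_nonneg fun k => norm_nonneg _) hle (by linarith)
  · exact intervalIntegral.integral_nonneg zero_le_one fun u _ => by positivity

end SmoothMultiplier
end Literature.NumberTheory.LFunctions
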